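import Summits.QuantumFields.BalabanUV.Beta.FP.RoadEndLeft
import Summits.QuantumFields.BalabanUV.Beta.FP.RoadEndPowdev

/-!
# `BalabanUV.Beta.FP.RoadEndLeftPowdev` — road «FP» for binder row D1, PROPOSED RULING R-FP-47 door (ii) «GHOST-RG», END v2′ link 3 (owner, gen 15):
# THE LEFT-PLACED END OF RECORD (K-SLOT DISCHARGED) WITH THE (STEP) BINDER WEAKENED TO A BOUNDED DEVIATION FROM THE POWER LAW —
# twins of `RoadEndLeft.d1Drift_left_of_step_law_bounded` ∕ `_wslot_split` with `hstep ↦ hdev : |fPerfG m − m·fPerfG 1| ≤ D`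

HONEST DEPENDENCY (page 1, mandatory): continuum YM on T⁴ ⇐ BetaPertH ∧ nine spine estimates (0/9 proved); BetaPertH ⇐ (D1) ∧ (D4) ∧ CAP+tail;
G-an2-4 gates asym, D1 and NE2/3/4.  HONEST FRAMING (cell contract, verbatim): «discharging `BetaPertH` makes Bałaban's UV stability UNCONDITIONAL —
a real constructive-QFT result; it is NOT the continuum limit and NOT the Clay problem.»  THIS MODULE is [our object] COMPOSITION BY NAME (two theorems; same
hypotheses as the gen-10 `RoadEndLeft` ENDs except the step-law binder; gan24's `convCKWall_holds`, asym1's `exists_merged_rows`, the gen-10 `hasym_left_of_wslot_split`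
and the gen-15 `RoadEndPowdev.d1Drift_of_self_powdev_bounded` BY NAME).  No `def`, no `def … : Prop`, nothing cited, 0 sorry; 0∕4 row-D1 binders — every binder is a
HYPOTHESIS shape; NOT (CONV-C), NOT SDF, NOT (ASYMP), NOT D1, NOT BetaPertH, NOT continuum, NOT Clay.  «not in print; our bookkeeping».

ABSOLUTE RULE (cell charter, verbatim): «No internally-minted statement may enter as a cited fact. Every hypothesis is either kernel-proved in this package or a
verbatim quotation of a PUBLISHED theorem with page reference. The manuscript(s) under audit are NOT citable for their own disputed steps — they are the thing
under adjudication; programme-internal (2001/route/tribunal) claims are never citable.»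

WHY (E-FP-15-2 ∕ PROPOSED R-FP-47, journal l.34659 ∕ l.34829): door (ii) «GHOST-RG» replaces road FP's exact (STEP) ∕ `hSDF` binder by «the perfect step defects have bounded
partial sums», i.e. the bounded deviation `|fPerfG m − m·fPerfG 1| ≤ D`; `RoadEndPowdev` threads it through the dressing-agnostic END; this file is the LEFT-placed END of
record (gan24's K-slot discharged inside), so that `RoadLeftAssembly*`'s twins (next links, swarm) are one-line substitutions.
CONTENTS: **`d1Drift_left_of_powdev_bounded`**, **`d1Drift_left_of_powdev_wslot_split`**.
Provenance: road FP OWNER b2b-balaban-beta-d1-p3 gen 15 (prover-b2b-balaban-beta-d1-p3-g15-0), 2026-08-21; new file, nothing appended to others' modules.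
-/

noncomputable section

namespace Summit.QuantumFields.BalabanUV.Beta.FP.RoadEndLeftPowdev

open Literature.MathematicalPhysics.QuantumFieldTheory.Balaban1983to89
open Literature.MathematicalPhysics.QuantumFieldTheory.Balaban1983to89.Beta
open Literature.MathematicalPhysics.QuantumFieldTheory.Balaban1983to89.B12Normalization (stepBal)
open ExpKernelCalculus (Site MKer Decays VertexFamily₂ tadpole hessKer)
open OneStepResolventKernel (Fib LocStencil JetData)
open OneStepKernelFamily (vertexOfK KInvStep TbalOf D1Drift)
open SecondOrderResponse (vertex2OfK)
open HessKerDressedLimit (limMKerOf limStOf limTabOf)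
open Summit.QuantumFields.BalabanUV.Beta.HessKerDressedUnits (unitK unitS unitW)
open Summit.QuantumFields.BalabanUV.Beta.HessKerConvCKPlug (exists_merged_rows)
open Summit.QuantumFields.BalabanUV.Beta.TameKernelCalculus (Spr Loc)
open Summit.QuantumFields.BalabanUV.Beta.GAN24.CombesThomas (sfStep smStep sfStep_ne_zero smStep_ne_zero ConvCKWall)
open Summit.QuantumFields.BalabanUV.Beta.GAN24.KSlotAssembly (convCKWall_holds)
open Summit.QuantumFields.BalabanUV.Beta.FP.PerfectObjects (KTot)
open Summit.QuantumFields.BalabanUV.Beta.FP.PerfectObjectsT (KPerf SPerfOf WPerfOf)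
open Summit.QuantumFields.BalabanUV.Beta.FP.RoadEndGeneric (fPerfG)
open Summit.QuantumFields.BalabanUV.Beta.FP.RoadEndLeft (fPerfG_std_eq hasym_left_of_wslot_split)
open Summit.QuantumFields.BalabanUV.Beta.FP.RoadEndPowdev (d1Drift_of_self_powdev_bounded)

section End

variable {Lc : ℕ} [NeZero Lc] (Js : ℕ → JetData 3 Lc)
  (S : ℕ → ℕ → Fin (3 + 1) → (Fin (3 + 1) → ℤ) → MKer (3 + 1) (Fib 3))
  (Wt : ℕ → ℕ → Fin (3 + 1) → (Fin (3 + 1) → ℤ) → Fin (3 + 1) → (Fin (3 + 1) → ℤ) → MKer (3 + 1) (Fib 3))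
  {Cs cS δS θS Cw cW δW θW : ℝ}

/-- **ROAD «FP», THE END AT THE PLACEMENT OF RECORD, K-SLOT DISCHARGED, BOUNDED-DEVIATION FORM** [our object] (`d = 3`, `2 ≤ Lc`, adopted units) — EXACTLY
`RoadEndLeft.d1Drift_left_of_step_law_bounded` with the STEP-LAW binder replaced by `hdev : ∀ m ≥ 1, |fPerfG m − m·fPerfG 1| ≤ D` (R-FP-47 door (ii) «GHOST-RG»:
Σ-bounded step defects; `RoadEndPowdev.d1Drift_of_self_powdev_bounded` underneath).  Discharges nothing else. -/
theorem d1Drift_left_of_powdev_bounded (hLc : 2 ≤ Lc)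
    (hS1 : ∀ j, S j 1 = (Js j).S) (hW1 : ∀ j, Wt j 1 = (Js j).W)
    (hS : ∀ j, LocStencil (unitS (sfStep Lc j) (smStep 3 Lc j) (Js j).S) Cs δS)
    (hSall : ∀ k j, LocStencil (unitS (sfStep Lc (k + j)) (smStep 3 Lc (k + j)) (Js (k + j)).S -
      unitS (sfStep Lc k) (smStep 3 Lc k) (Js k).S) (cS * θS ^ k) δS)
    (hW : ∀ j, VertexFamily₂ (unitW (sfStep Lc j) (smStep 3 Lc j) (Js j).W) Lc Cw δW)
    (hWall : ∀ k j, VertexFamily₂ (unitW (sfStep Lc (k + j)) (smStep 3 Lc (k + j)) (Js (k + j)).W -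
      unitW (sfStep Lc k) (smStep 3 Lc k) (Js k).W) Lc (cW * θW ^ k) δW)
    (hδS : 0 < δS) (hδW : 0 < δW) (hθS0 : 0 ≤ θS) (hθS1 : θS < 1) (hθW0 : 0 ≤ θW) (hθW1 : θW < 1) (μ ν : Fin 4) {N Cg D : ℝ}
    (hdev : ∀ m : ℕ, 1 ≤ m →
      |fPerfG Lc (sfStep Lc) (smStep 3 Lc) (fun j m => KTot (d := 3) (Lc ^ (j + m)) (Lc ^ j)) (fun j m => KTot (d := 3) (Lc ^ (j + m)) (Lc ^ j))
          S Wt μ ν m -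
        (m : ℝ) * fPerfG Lc (sfStep Lc) (smStep 3 Lc) (fun j m => KTot (d := 3) (Lc ^ (j + m)) (Lc ^ j)) (fun j m => KTot (d := 3) (Lc ^ (j + m)) (Lc ^ j))
          S Wt μ ν 1| ≤ D)
    (hasym : ∀ m : ℕ, 1 ≤ m →
      |B12Beta.secondMoment (hessKer (KPerf (d := 3) Lc (sfStep Lc) (smStep 3 Lc) m)
          (vertexOfK (KPerf (d := 3) Lc (sfStep Lc) (smStep 3 Lc) m) (Lc ^ m) (SPerfOf (sfStep Lc) (smStep 3 Lc) S m))
          (WPerfOf (sfStep Lc) (smStep 3 Lc) Wt m)) μ ν - (m : ℝ) * stepBal N Lc| ≤ Cg) :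
    D1Drift Lc Js N μ ν := by
  obtain ⟨C, δK, cK, θ, R, hR, hRK, hRS, hRW, hθ0, hθ1, hK, hKall, hSall', hWall'⟩ :=
    exists_merged_rows (Lc := Lc) (convCKWall_holds hLc) (S := fun j => unitS (sfStep Lc j) (smStep 3 Lc j) (Js j).S)
      (W := fun j => unitW (sfStep Lc j) (smStep 3 Lc j) (Js j).W) hSall hWall hδS hδW hθS0 hθS1 hθW0 hθW1
  exact d1Drift_of_self_powdev_bounded Js (sfStep Lc) (smStep 3 Lc) (fun j m => KTot (d := 3) (Lc ^ (j + m)) (Lc ^ j)) S Wt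
    sfStep_ne_zero smStep_ne_zero (fun j => rfl) hS1 hW1 hK hKall hS hSall' hW hWall' hR (by linarith) hRS hRW hθ0 hθ1 μ ν hdev
    (fun m hm => by rw [fPerfG_std_eq]; exact hasym m hm)


/-- **… WITH THE W-SLOT SPLIT FOLDED IN, BOUNDED-DEVIATION FORM** [our object] — `RoadEndLeft.d1Drift_left_of_step_law_wslot_split` with `hstep ↦ hdev`
((ASYMP) asked of the bi-vertex kernel only, the extra piece's bound `B` displayed; `RoadEndLeft.hasym_left_of_wslot_split` BY NAME). -/
theorem d1Drift_left_of_powdev_wslot_split (hLc : 2 ≤ Lc)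
    (hS1 : ∀ j, S j 1 = (Js j).S) (hW1 : ∀ j, Wt j 1 = (Js j).W)
    (hS : ∀ j, LocStencil (unitS (sfStep Lc j) (smStep 3 Lc j) (Js j).S) Cs δS)
    (hSall : ∀ k j, LocStencil (unitS (sfStep Lc (k + j)) (smStep 3 Lc (k + j)) (Js (k + j)).S -
      unitS (sfStep Lc k) (smStep 3 Lc k) (Js k).S) (cS * θS ^ k) δS)
    (hW : ∀ j, VertexFamily₂ (unitW (sfStep Lc j) (smStep 3 Lc j) (Js j).W) Lc Cw δW)
    (hWall : ∀ k j, VertexFamily₂ (unitW (sfStep Lc (k + j)) (smStep 3 Lc (k + j)) (Js (k + j)).W -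
      unitW (sfStep Lc k) (smStep 3 Lc k) (Js k).W) Lc (cW * θW ^ k) δW)
    (hδS : 0 < δS) (hδW : 0 < δW) (hθS0 : 0 ≤ θS) (hθS1 : θS < 1) (hθW0 : 0 ≤ θW) (hθW1 : θW < 1) (μ ν : Fin 4) {N D : ℝ}
    (hdev : ∀ m : ℕ, 1 ≤ m →
      |fPerfG Lc (sfStep Lc) (smStep 3 Lc) (fun j m => KTot (d := 3) (Lc ^ (j + m)) (Lc ^ j)) (fun j m => KTot (d := 3) (Lc ^ (j + m)) (Lc ^ j))
          S Wt μ ν m -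
        (m : ℝ) * fPerfG Lc (sfStep Lc) (smStep 3 Lc) (fun j m => KTot (d := 3) (Lc ^ (j + m)) (Lc ^ j)) (fun j m => KTot (d := 3) (Lc ^ (j + m)) (Lc ^ j))
          S Wt μ ν 1| ≤ D)
    -- the W-slot split of the perfect second-order slot (row #14), with its letters
    {Wf Wx : ℕ → Fin (3 + 1) → (Fin (3 + 1) → ℤ) → Fin (3 + 1) → (Fin (3 + 1) → ℤ) → MKer (3 + 1) (Fib 3)}
    (hsplit : ∀ m : ℕ, 1 ≤ m →
      WPerfOf (sfStep Lc) (smStep 3 Lc) Wt m = vertex2OfK (KPerf (d := 3) Lc (sfStep Lc) (smStep 3 Lc) m) (Lc ^ m) (Wf m) + Wx m)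
    (hloc₀ : ∀ m : ℕ, 1 ≤ m → ∀ z, Loc (vertex2OfK (KPerf (d := 3) Lc (sfStep Lc) (smStep 3 Lc) m) (Lc ^ m) (Wf m) μ 0 ν z))
    (hlocx : ∀ m : ℕ, 1 ≤ m → ∀ z, Loc (Wx m μ 0 ν z))
    (hs₀ : ∀ m : ℕ, 1 ≤ m → B14DeltaBeta.MomentSummable
      (hessKer (KPerf (d := 3) Lc (sfStep Lc) (smStep 3 Lc) m)
        (vertexOfK (KPerf (d := 3) Lc (sfStep Lc) (smStep 3 Lc) m) (Lc ^ m) (SPerfOf (sfStep Lc) (smStep 3 Lc) S m))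
        (vertex2OfK (KPerf (d := 3) Lc (sfStep Lc) (smStep 3 Lc) m) (Lc ^ m) (Wf m))) μ ν)
    (hsx : ∀ m : ℕ, 1 ≤ m → B14DeltaBeta.MomentSummable
      (fun μ' ν' z => (1 / 2 : ℝ) * tadpole (KPerf (d := 3) Lc (sfStep Lc) (smStep 3 Lc) m) (Wx m μ' 0 ν' z)) μ ν)
    {Cg B : ℝ}
    -- (ASYMP) at the bi-vertex kernel (the (LEDGER) skeleton's LEFT conclusion) and the extra piece's bound
    (hasym₀ : ∀ m : ℕ, 1 ≤ m →
      |B12Beta.secondMoment (hessKer (KPerf (d := 3) Lc (sfStep Lc) (smStep 3 Lc) m)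
          (vertexOfK (KPerf (d := 3) Lc (sfStep Lc) (smStep 3 Lc) m) (Lc ^ m) (SPerfOf (sfStep Lc) (smStep 3 Lc) S m))
          (vertex2OfK (KPerf (d := 3) Lc (sfStep Lc) (smStep 3 Lc) m) (Lc ^ m) (Wf m))) μ ν - (m : ℝ) * stepBal N Lc| ≤ Cg)
    (hextra : ∀ m : ℕ, 1 ≤ m →
      |B12Beta.secondMoment
          (fun μ' ν' z => (1 / 2 : ℝ) * tadpole (KPerf (d := 3) Lc (sfStep Lc) (smStep 3 Lc) m) (Wx m μ' 0 ν' z)) μ ν| ≤ B) :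
    D1Drift Lc Js N μ ν :=
  d1Drift_left_of_powdev_bounded Js S Wt hLc hS1 hW1 hS hSall hW hWall hδS hδW hθS0 hθS1 hθW0 hθW1 μ ν hdev
    (hasym_left_of_wslot_split hLc (S := fun m => SPerfOf (sfStep Lc) (smStep 3 Lc) S m)
      (Wt := fun m => WPerfOf (sfStep Lc) (smStep 3 Lc) Wt m)
      (W₀ := fun m => vertex2OfK (KPerf (d := 3) Lc (sfStep Lc) (smStep 3 Lc) m) (Lc ^ m) (Wf m)) (Wx := Wx)
      hsplit hloc₀ hlocx hs₀ hsx hasym₀ hextra)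

end End

end Summit.QuantumFields.BalabanUV.Beta.FP.RoadEndLeftPowdev

end
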